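import Literature.Geometry.Lorentzian.TeukolskyRadialSchrodingerForm
import Literature.Geometry.Lorentzian.TeukolskyHorizonNormalisedLimits
import Literature.Geometry.Lorentzian.KerrSeparatedPotentialBounds
import Literature.Geometry.Lorentzian.KerrTortoiseRadius
import Literature.Analysis.ODE.SoninEnvelope
import HarnessLib

/-!
# Horizon-side envelopes of the horizon-normalised scalar radial solution `R_{𝓗⁺}` on a
# monotone stretch `(r₊, r₁]` of Carter's potential

(namespace `Literature.Geometry.Lorentzian.Kerr.Costa2019`; a bridge lemma toward the cone
Green-kernel bound for the scalar radial Teukolsky pair of R. Teixeira da Costa,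
arXiv:1910.02854, Def. 2.3.)

For `0 < M`, `|a| < M`, a classical solution `R` of the scalar (`s = 0`) radial Teukolsky ODE with
`λ = Λ − a²ω²` (`Kerr.IsRadialTeukolskySolution`) normalised at `𝓗⁺`
(`Kerr.IsNormalisedHorizonSolution M a 0 ω m R`, TdC Def. 2.3), write `u = (r² + a²)^{1/2} R`,
`u′ = du/dr* = (Δ/(r² + a²)) d/dr[(r² + a²)^{1/2} R]`, `Φ = ω² − V`,
`V = Kerr.sepPotential M a ω m Λ`, `σ = ω − mω₊`. At the horizon end `r → r₊⁺` (`r* → −∞`):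
`|u| → 1`, `|u′| → |σ|` (`Costa2019.tendsto_norm_horizonSolution`,
`Costa2019.tendsto_norm_deriv_horizonSolution`) and `Φ → Φ(r₊) = σ²` (DRSR Lemma 6.3.2,
`Kerr.omega_sq_sub_sepPotential_rPlus`). Along a tortoise radius function `ρ`
(`Kerr.IsTortoiseRadius`), `u ∘ ρ` solves Carter's equation `u″ + Φ u = 0`
(`Kerr.schrodingerForm`), so the Sonin–Pólya energy `E = Φ|u|² + |u′|²` has `E′ = Φ′|u|²` and
the Sonin envelope `N = |u|² + |u′|²/Φ` (`Φ > 0`) has `N′ = −Φ′|u′|²/Φ²`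
(`Literature.Analysis.ODE.hasDerivAt_soninEnergy`, `…hasDerivAt_soninEnvelope`). On a stretch
`(r₊, r₁]` next to the horizon on which `V` is monotone this gives, for every `r ∈ (r₊, r₁]`:

* `Costa2019.horizonEnvelope_of_monotoneOn` — if `V` is non-decreasing on `(r₊, r₁]` (`Φ`
  non-increasing in `r*`, `E` non-increasing, `E ≤ E(−∞) = σ²·1 + σ²`):
  `Φ(r)·(r² + a²)|R(r)|² + (Δ/(r² + a²))²|d/dr[(r² + a²)^{1/2} R](r)|² ≤ 2σ²`
  (so `|u_𝓗′|² ≤ 2σ²` all the way into the barrier);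
* `Costa2019.horizonEnvelope_of_antitoneOn` — if `V` is non-increasing on `(r₊, r₁]` and
  `σ ≠ 0` (`Φ` non-decreasing in `r*` from `Φ(−∞) = σ² > 0`, `N` non-increasing,
  `N ≤ N(−∞) = 1 + σ²/σ² = 2`): `(r² + a²)|R(r)|² ≤ 2` and
  `(Δ/(r² + a²))²|d/dr[(r² + a²)^{1/2} R](r)|² ≤ 2Φ(r)`.

The sign of `dV/dr` inside the stretch is read off the monotonicity
(`MonotoneOn.derivWithin_nonneg`); no fine structure of `V` is used. These are the elementary
`Q^y`-current (`y ≡ 1`) bounds for the horizon solution with the boundary condition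
`u′ + iσu = 0` at `r* = −∞` of Dafermos–Rodnianski–Shlapentokh-Rothman (arXiv:1402.7034, §5.3,
§6.4). Everything is proved; theorems only.

## References
* M. Dafermos, I. Rodnianski, Y. Shlapentokh-Rothman, *Decay for solutions of the wave equation
  on Kerr exterior spacetimes III*, arXiv:1402.7034 = Ann. of Math. 183 (2016): §5.2.3 (Carter's
  equation), §5.3 (horizon boundary condition), Lemma 6.3.2 (`ω² − V(r₊)`), §6.4 (monotonicity
  of `V` next to `r₊`). [DafermosRodnianskiShlapentokhrothman2014]
* R. Teixeira da Costa, *Mode stability for the Teukolsky equation on extremal and subextremal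
  Kerr spacetimes*, CMP 378 (2020) 705–781 = arXiv:1910.02854: Def. 2.3 (`R_{𝓗⁺}`). [Costa2019]
-/

noncomputable section

open Filter Set Topology

namespace Literature.Geometry.Lorentzian.Kerr

namespace Costa2019

/-! ### Along a tortoise radius: the horizon end `x → −∞` -/

-- Along a tortoise radius function `ρ`, `x → −∞` is `r → r₊⁺` (`ρ → r₊` at `−∞`, `ρ > r₊`):
-- this is `Costa2019.tendsto_tortoise_atBot_nhdsWithin`; surjectivity of `ρ` onto `(r₊, ∞)` is
-- `Costa2019.tortoise_exists_eq` (both in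
-- Literature/Geometry/Lorentzian/TeukolskyWhitingEndgame.lean, in the import closure).

/-! ### Horizon data of `u_𝓗 = (ρ² + a²)^{1/2} R_𝓗 ∘ ρ` as `x → −∞` -/

/-- `|u_𝓗(x)| = (ρ² + a²)^{1/2}|R(ρ x)| → 1` as `x → −∞` (the normalisation of TdC Def. 2.3,
`Costa2019.tendsto_norm_horizonSolution`, along `ρ → r₊⁺`). [cite: Costa2019, Definition 2.3] -/
private theorem tendsto_norm_u {M a ω m : ℝ} {R : ℝ → ℂ}
    (hn : IsNormalisedHorizonSolution M a 0 ω m R) {ρ : ℝ → ℝ} (hρ : IsTortoiseRadius M a ρ) :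
    Tendsto (fun y ↦ ‖((Real.sqrt (ρ y ^ 2 + a ^ 2) : ℝ) : ℂ) * R (ρ y)‖) atBot (𝓝 1) := by
  refine ((tendsto_norm_horizonSolution hn).comp (tendsto_tortoise_atBot_nhdsWithin hρ)).congr
    fun y ↦ ?_
  rw [norm_mul, Complex.norm_of_nonneg (Real.sqrt_nonneg _)]
  rfl

/-- `|u_𝓗′(x)| → |ω − mω₊|` as `x → −∞`, for the tortoise derivative
`u₁ = (Δ/(r² + a²)) d/dr[(r² + a²)^{1/2} R]` at `r = ρ x` (`0 < M`, `|a| < M`;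
`Costa2019.tendsto_norm_deriv_horizonSolution` along `ρ → r₊⁺`).
[cite: Costa2019, Definition 2.3] -/
private theorem tendsto_norm_u₁ {M a ω m : ℝ} (hM : 0 < M) (ha : |a| < M) {R : ℝ → ℂ}
    (hn : IsNormalisedHorizonSolution M a 0 ω m R) {ρ : ℝ → ℝ} (hρ : IsTortoiseRadius M a ρ)
    {u₁ : ℝ → ℂ} (hu₁ : ∀ x, u₁ x = ((delta M a (ρ x) / (ρ x ^ 2 + a ^ 2) : ℝ) : ℂ) *
      deriv (fun r : ℝ ↦ ((Real.sqrt (r ^ 2 + a ^ 2) : ℝ) : ℂ) * R r) (ρ x)) :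
    Tendsto (fun y ↦ ‖u₁ y‖) atBot (𝓝 |ω - m * horizonAngularVelocity M a|) := by
  have hsub : IsSubextremal M a := ha
  refine ((tendsto_norm_deriv_horizonSolution hM ha hn).comp
    (tendsto_tortoise_atBot_nhdsWithin hρ)).congr fun y ↦ ?_
  rw [hu₁ y, norm_mul, Complex.norm_of_nonneg (hρ.deriv_pos hsub y).le]
  rfl

/-- `Φ(ρ x) = ω² − V(ρ x) → (ω − mω₊)²` as `x → −∞`: `V` is continuous at `r₊ > 0` and
`ω² − V(r₊) = (2Mr₊ω − am)²/(4M²r₊²) = (ω − mω₊)²`, `ω₊ = a/(2Mr₊)` (DRSR Lemma 6.3.2,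
`Kerr.omega_sq_sub_sepPotential_rPlus`).
[cite: DafermosRodnianskiShlapentokhrothman2014, Lemma 6.3.2] -/
private theorem tendsto_phi_atBot {M a : ℝ} (hM : 0 < M) (ha : |a| < M) (ω : ℝ) (m : ℤ) (Λ : ℝ)
    {ρ : ℝ → ℝ} (hρ : IsTortoiseRadius M a ρ) :
    Tendsto (fun y ↦ ω ^ 2 - sepPotential M a ω m Λ (ρ y)) atBot
      (𝓝 ((ω - m * horizonAngularVelocity M a) ^ 2)) := by
  have hrp : 0 < rPlus M a := rPlus_pos hM a
  have hA : rPlus M a ^ 2 + a ^ 2 ≠ 0 := by positivity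
  have hVc : ContinuousAt (fun r ↦ ω ^ 2 - sepPotential M a ω m Λ r) (rPlus M a) :=
    ((hasDerivAt_sepPotential M a ω m Λ hA).const_sub (ω ^ 2)).continuousAt
  have hVv : ω ^ 2 - sepPotential M a ω m Λ (rPlus M a) =
      (ω - m * horizonAngularVelocity M a) ^ 2 := by
    have h0 : 2 * M * rPlus M a ≠ 0 := by positivity
    rw [omega_sq_sub_sepPotential_rPlus ha.le hM, horizonAngularVelocity]
    field_simp
    ring
  rw [← hVv]
  exact hVc.tendsto.comp hρ.tendsto_atBot

/-! ### Case (a): `V` non-decreasing on `(r₊, r₁]` — the Sonin energy is non-increasing in `r*` -/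

/-- **Horizon Sonin-energy bound on an increasing stretch of `V`.** For `0 < M`, `|a| < M`, a
classical solution `R` of the scalar radial Teukolsky ODE (`λ = Λ − a²ω²`) normalised at `𝓗⁺`
(TdC Def. 2.3), and a stretch `(r₊, r₁]` on which `V = Kerr.sepPotential M a ω m Λ` is
non-decreasing: for every `r ∈ (r₊, r₁]`,
`(ω² − V(r))·(r² + a²)|R(r)|² + (Δ/(r² + a²))²|d/dr[(r² + a²)^{1/2} R](r)|² ≤ 2(ω − mω₊)²`, i.e.
the Sonin energy `E = (ω² − V)|u|² + |u′|²` of `u = (r² + a²)^{1/2} R` (`′ = d/dr*`) is at most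
its horizon value `(ω − mω₊)²·1 + (ω − mω₊)²`: in the tortoise variable
`E′ = −(dV/dr)(dr/dr*)|u|² ≤ 0` on the stretch (the `Q^y`-current with `y ≡ 1` and the horizon
boundary condition `u′ + i(ω − mω₊)u = 0` of DRSR arXiv:1402.7034, §5.3; the monotone stretch
next to `r₊` is that of §6.4). [cite: DafermosRodnianskiShlapentokhrothman2014, §6.4] -/
theorem horizonEnvelope_of_monotoneOn {M a ω Λ : ℝ} {m : ℤ} (hM : 0 < M) (ha : |a| < M)
    {R : ℝ → ℂ} (hR : IsRadialTeukolskySolution M a 0 ω m (Λ - a ^ 2 * ω ^ 2) R)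
    (hn : IsNormalisedHorizonSolution M a 0 ω m R) {r₁ : ℝ}
    (hmono : MonotoneOn (sepPotential M a ω m Λ) (Ioc (rPlus M a) r₁)) {r : ℝ}
    (hr : r ∈ Ioc (rPlus M a) r₁) :
    (ω ^ 2 - sepPotential M a ω m Λ r) * ((r ^ 2 + a ^ 2) * ‖R r‖ ^ 2) +
      (delta M a r / (r ^ 2 + a ^ 2)) ^ 2 *
        ‖deriv (fun s : ℝ ↦ ((Real.sqrt (s ^ 2 + a ^ 2) : ℝ) : ℂ) * R s) r‖ ^ 2 ≤
      2 * (ω - m * horizonAngularVelocity M a) ^ 2 := by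
  have hsub : IsSubextremal M a := ha
  -- Carter's variable: a tortoise radius `ρ` and `x₀` with `ρ x₀ = r`
  obtain ⟨ρ, hρ⟩ := exists_isTortoiseRadius hsub
  obtain ⟨x₀, rfl⟩ := tortoise_exists_eq hρ hr.1
  -- `u = √(ρ² + a²)·R ∘ ρ`, its tortoise derivative `u₁`, Carter's equation
  obtain ⟨u₁, u₂, hu⟩ := schrodingerForm hM ha hR hρ
  -- the Sonin energy `E = (ω² − V(ρ y))|u y|² + |u₁ y|²` has `E′ = −V′(ρ y) ρ′(y) |u y|²`
  have hE : ∀ y, HasDerivAt (fun y ↦ (ω ^ 2 - sepPotential M a ω m Λ (ρ y)) *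
        ‖((Real.sqrt (ρ y ^ 2 + a ^ 2) : ℝ) : ℂ) * R (ρ y)‖ ^ 2 + ‖u₁ y‖ ^ 2)
      (-(deriv (sepPotential M a ω m Λ) (ρ y) * (delta M a (ρ y) / (ρ y ^ 2 + a ^ 2))) *
        ‖((Real.sqrt (ρ y ^ 2 + a ^ 2) : ℝ) : ℂ) * R (ρ y)‖ ^ 2) y := fun y ↦ by
    obtain ⟨h1, h2, h3, -⟩ := hu y
    have hA : ρ y ^ 2 + a ^ 2 ≠ 0 := (hρ.sq_add_sq_pos hsub y).ne'
    have hV := (hasDerivAt_sepPotential M a ω m Λ hA).differentiableAt.hasDerivAt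
    rw [eq_neg_of_add_eq_zero_left h3, ← neg_mul] at h2
    exact Literature.Analysis.ODE.hasDerivAt_soninEnergy
      (φ := fun y ↦ ω ^ 2 - sepPotential M a ω m Λ (ρ y)) h1 h2
      ((hV.comp y (hρ.hasDerivAt y)).const_sub (ω ^ 2))
  -- `E` is non-increasing on `(−∞, x₀]`: for `y < x₀`, `r₊ < ρ y < ρ x₀ ≤ r₁`, so `V′(ρ y) ≥ 0`
  have hanti : AntitoneOn (fun y ↦ (ω ^ 2 - sepPotential M a ω m Λ (ρ y)) *
        ‖((Real.sqrt (ρ y ^ 2 + a ^ 2) : ℝ) : ℂ) * R (ρ y)‖ ^ 2 + ‖u₁ y‖ ^ 2) (Iic x₀) := by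
    refine antitoneOn_of_deriv_nonpos (convex_Iic x₀)
      (fun y _ ↦ (hE y).continuousAt.continuousWithinAt)
      (fun y _ ↦ (hE y).differentiableAt.differentiableWithinAt) ?_
    intro y hy
    rw [interior_Iic] at hy
    have hy' : ρ y < r₁ := (hρ.strictMono hsub (mem_Iio.1 hy)).trans_le hr.2
    have hVd : 0 ≤ deriv (sepPotential M a ω m Λ) (ρ y) := by
      rw [← derivWithin_of_mem_nhds (Ioc_mem_nhds (hρ.rPlus_lt y) hy')]
      exact hmono.derivWithin_nonneg
    rw [(hE y).deriv]
    exact mul_nonpos_of_nonpos_of_nonneg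
      (neg_nonpos.2 (mul_nonneg hVd (hρ.deriv_pos hsub y).le)) (sq_nonneg _)
  -- `E → (ω − mω₊)²·1² + |ω − mω₊|² = 2(ω − mω₊)²` at `−∞`
  have hlim : Tendsto (fun y ↦ (ω ^ 2 - sepPotential M a ω m Λ (ρ y)) *
        ‖((Real.sqrt (ρ y ^ 2 + a ^ 2) : ℝ) : ℂ) * R (ρ y)‖ ^ 2 + ‖u₁ y‖ ^ 2) atBot
      (𝓝 (2 * (ω - m * horizonAngularVelocity M a) ^ 2)) := by
    have h := ((tendsto_phi_atBot hM ha ω m Λ hρ).mul ((tendsto_norm_u hn hρ).pow 2)).add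
      ((tendsto_norm_u₁ hM ha hn hρ fun x ↦ (hu x).2.2.2).pow 2)
    rw [one_pow, mul_one, sq_abs, ← two_mul] at h
    exact h
  -- antitone + limit: `E(x₀) ≤ 2(ω − mω₊)²`
  have key : (ω ^ 2 - sepPotential M a ω m Λ (ρ x₀)) *
        ‖((Real.sqrt (ρ x₀ ^ 2 + a ^ 2) : ℝ) : ℂ) * R (ρ x₀)‖ ^ 2 + ‖u₁ x₀‖ ^ 2 ≤
      2 * (ω - m * horizonAngularVelocity M a) ^ 2 := by
    refine ge_of_tendsto hlim ?_
    filter_upwards [eventually_le_atBot x₀] with y hy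
    exact hanti hy self_mem_Iic hy
  -- back to `R`: `|u x₀|² = (r² + a²)|R r|²`, `|u₁ x₀|² = (Δ/(r² + a²))² |d/dr[√(r² + a²) R]|²`
  have hA : 0 ≤ ρ x₀ ^ 2 + a ^ 2 := (hρ.sq_add_sq_pos hsub x₀).le
  rw [norm_mul, Complex.norm_of_nonneg (Real.sqrt_nonneg _), mul_pow, Real.sq_sqrt hA,
    (hu x₀).2.2.2, norm_mul, Complex.norm_of_nonneg (hρ.deriv_pos hsub x₀).le, mul_pow] at key
  exact key

/-! ### Case (b): `V` non-increasing on `(r₊, r₁]` — the Sonin envelope is non-increasing -/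

/-- **Horizon envelope on a decreasing stretch of `V`.** For `0 < M`, `|a| < M`,
`ω ≠ mω₊` (`ω₊ = a/(2Mr₊)`), a classical solution `R` of the scalar radial Teukolsky ODE
(`λ = Λ − a²ω²`) normalised at `𝓗⁺` (TdC Def. 2.3), and a stretch `(r₊, r₁]` on which
`V = Kerr.sepPotential M a ω m Λ` is non-increasing: for every `r ∈ (r₊, r₁]`,
`(r² + a²)|R(r)|² ≤ 2` and `(Δ/(r² + a²))²|d/dr[(r² + a²)^{1/2} R](r)|² ≤ 2(ω² − V(r))`, i.e.
`|u|² ≤ 2`, `|u′|² ≤ 2Φ` for `u = (r² + a²)^{1/2} R`, `′ = d/dr*`, `Φ = ω² − V`: in the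
tortoise variable `Φ` is non-decreasing from its horizon value `Φ(−∞) = (ω − mω₊)² > 0`
(DRSR Lemma 6.3.2), so the Sonin envelope `N = |u|² + |u′|²/Φ`, `N′ = −Φ′|u′|²/Φ² ≤ 0`, is at
most its horizon value `1 + (ω − mω₊)²/(ω − mω₊)² = 2` (horizon boundary condition
`u′ + i(ω − mω₊)u = 0` of DRSR arXiv:1402.7034, §5.3), and `|u|² ≤ N`, `|u′|² ≤ ΦN`.
[cite: DafermosRodnianskiShlapentokhrothman2014, §6.4] -/
theorem horizonEnvelope_of_antitoneOn {M a ω Λ : ℝ} {m : ℤ} (hM : 0 < M) (ha : |a| < M)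
    (hσ : ω ≠ m * horizonAngularVelocity M a) {R : ℝ → ℂ}
    (hR : IsRadialTeukolskySolution M a 0 ω m (Λ - a ^ 2 * ω ^ 2) R)
    (hn : IsNormalisedHorizonSolution M a 0 ω m R) {r₁ : ℝ}
    (hanti : AntitoneOn (sepPotential M a ω m Λ) (Ioc (rPlus M a) r₁)) {r : ℝ}
    (hr : r ∈ Ioc (rPlus M a) r₁) :
    (r ^ 2 + a ^ 2) * ‖R r‖ ^ 2 ≤ 2 ∧
    (delta M a r / (r ^ 2 + a ^ 2)) ^ 2 *
        ‖deriv (fun s : ℝ ↦ ((Real.sqrt (s ^ 2 + a ^ 2) : ℝ) : ℂ) * R s) r‖ ^ 2 ≤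
      2 * (ω ^ 2 - sepPotential M a ω m Λ r) := by
  have hsub : IsSubextremal M a := ha
  have hσ2 : 0 < (ω - m * horizonAngularVelocity M a) ^ 2 :=
    sq_pos_of_ne_zero (sub_ne_zero.2 hσ)
  -- Carter's variable: a tortoise radius `ρ` and `x₀` with `ρ x₀ = r`
  obtain ⟨ρ, hρ⟩ := exists_isTortoiseRadius hsub
  obtain ⟨x₀, rfl⟩ := tortoise_exists_eq hρ hr.1
  -- `u = √(ρ² + a²)·R ∘ ρ`, its tortoise derivative `u₁`, Carter's equation
  obtain ⟨u₁, u₂, hu⟩ := schrodingerForm hM ha hR hρ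
  -- `Φ(y) = ω² − V(ρ y)` is non-decreasing on `(−∞, x₀]` with limit `(ω − mω₊)²` at `−∞`,
  -- hence `Φ ≥ (ω − mω₊)² > 0` there
  have hmem : ∀ y, y ≤ x₀ → ρ y ∈ Ioc (rPlus M a) r₁ := fun y hy ↦
    ⟨hρ.rPlus_lt y, ((hρ.strictMono hsub).monotone hy).trans hr.2⟩
  have hΦmono : MonotoneOn (fun y ↦ ω ^ 2 - sepPotential M a ω m Λ (ρ y)) (Iic x₀) :=
    fun y hy z hz hyz ↦ sub_le_sub_left
      (hanti (hmem y hy) (hmem z hz) ((hρ.strictMono hsub).monotone hyz)) _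
  have hΦlim := tendsto_phi_atBot hM ha ω m Λ hρ
  have hΦpos : ∀ y, y ≤ x₀ → 0 < ω ^ 2 - sepPotential M a ω m Λ (ρ y) := fun y hy ↦ by
    refine hσ2.trans_le (le_of_tendsto hΦlim ?_)
    filter_upwards [eventually_le_atBot y] with z hz
    exact hΦmono (hz.trans hy) hy hz
  -- the Sonin envelope `N = |u|² + |u₁|²/Φ` has `N′ = −Φ′|u₁|²/Φ²`, `Φ′ = −V′(ρ y) ρ′(y)`
  have hN : ∀ y, y ≤ x₀ → HasDerivAt (fun y ↦
        ‖((Real.sqrt (ρ y ^ 2 + a ^ 2) : ℝ) : ℂ) * R (ρ y)‖ ^ 2 +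
          ‖u₁ y‖ ^ 2 / (ω ^ 2 - sepPotential M a ω m Λ (ρ y)))
      (-(-(deriv (sepPotential M a ω m Λ) (ρ y) * (delta M a (ρ y) / (ρ y ^ 2 + a ^ 2))) *
          ‖u₁ y‖ ^ 2) / (ω ^ 2 - sepPotential M a ω m Λ (ρ y)) ^ 2) y := fun y hy ↦ by
    obtain ⟨h1, h2, h3, -⟩ := hu y
    have hA : ρ y ^ 2 + a ^ 2 ≠ 0 := (hρ.sq_add_sq_pos hsub y).ne'
    have hV := (hasDerivAt_sepPotential M a ω m Λ hA).differentiableAt.hasDerivAt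
    rw [eq_neg_of_add_eq_zero_left h3, ← neg_mul] at h2
    exact Literature.Analysis.ODE.hasDerivAt_soninEnvelope
      (φ := fun y ↦ ω ^ 2 - sepPotential M a ω m Λ (ρ y)) h1 h2
      ((hV.comp y (hρ.hasDerivAt y)).const_sub (ω ^ 2)) (hΦpos y hy).ne'
  -- `N` is non-increasing on `(−∞, x₀]`: for `y < x₀`, `r₊ < ρ y < ρ x₀ ≤ r₁`, so `V′(ρ y) ≤ 0`
  have hNanti : AntitoneOn (fun y ↦
      ‖((Real.sqrt (ρ y ^ 2 + a ^ 2) : ℝ) : ℂ) * R (ρ y)‖ ^ 2 +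
        ‖u₁ y‖ ^ 2 / (ω ^ 2 - sepPotential M a ω m Λ (ρ y))) (Iic x₀) := by
    refine antitoneOn_of_deriv_nonpos (convex_Iic x₀)
      (fun y hy ↦ (hN y hy).continuousAt.continuousWithinAt)
      (fun y hy ↦ (hN y (mem_Iic.1 (interior_subset hy))).differentiableAt.differentiableWithinAt)
      ?_
    intro y hy
    rw [interior_Iic] at hy
    have hy₀ : y < x₀ := mem_Iio.1 hy
    have hy' : ρ y < r₁ := (hρ.strictMono hsub hy₀).trans_le hr.2
    have hVd : deriv (sepPotential M a ω m Λ) (ρ y) ≤ 0 := by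
      rw [← derivWithin_of_mem_nhds (Ioc_mem_nhds (hρ.rPlus_lt y) hy')]
      exact hanti.derivWithin_nonpos
    rw [(hN y hy₀.le).deriv]
    have h0 : 0 ≤ -(deriv (sepPotential M a ω m Λ) (ρ y) *
        (delta M a (ρ y) / (ρ y ^ 2 + a ^ 2))) * ‖u₁ y‖ ^ 2 :=
      mul_nonneg (neg_nonneg.2 (mul_nonpos_of_nonpos_of_nonneg hVd (hρ.deriv_pos hsub y).le))
        (sq_nonneg _)
    exact div_nonpos_of_nonpos_of_nonneg (neg_nonpos.2 h0) (sq_nonneg _)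
  -- `N → 1² + |ω − mω₊|²/(ω − mω₊)² = 2` at `−∞`
  have hlim : Tendsto (fun y ↦
      ‖((Real.sqrt (ρ y ^ 2 + a ^ 2) : ℝ) : ℂ) * R (ρ y)‖ ^ 2 +
        ‖u₁ y‖ ^ 2 / (ω ^ 2 - sepPotential M a ω m Λ (ρ y))) atBot (𝓝 2) := by
    have h := ((tendsto_norm_u hn hρ).pow 2).add
      (((tendsto_norm_u₁ hM ha hn hρ fun x ↦ (hu x).2.2.2).pow 2).div hΦlim hσ2.ne')
    rw [one_pow, sq_abs, div_self hσ2.ne', one_add_one_eq_two] at h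
    exact h
  -- antitone + limit: `N(x₀) ≤ 2`
  have key : ‖((Real.sqrt (ρ x₀ ^ 2 + a ^ 2) : ℝ) : ℂ) * R (ρ x₀)‖ ^ 2 +
      ‖u₁ x₀‖ ^ 2 / (ω ^ 2 - sepPotential M a ω m Λ (ρ x₀)) ≤ 2 := by
    refine ge_of_tendsto hlim ?_
    filter_upwards [eventually_le_atBot x₀] with y hy
    exact hNanti hy self_mem_Iic hy
  -- back to `R`: `|u x₀|² = (r² + a²)|R r|²`, `|u₁ x₀|² = (Δ/(r² + a²))² |d/dr[√(r² + a²) R]|²`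
  have hΦ0 := hΦpos x₀ le_rfl
  have hA : 0 ≤ ρ x₀ ^ 2 + a ^ 2 := (hρ.sq_add_sq_pos hsub x₀).le
  rw [norm_mul, Complex.norm_of_nonneg (Real.sqrt_nonneg _), mul_pow, Real.sq_sqrt hA,
    (hu x₀).2.2.2, norm_mul, Complex.norm_of_nonneg (hρ.deriv_pos hsub x₀).le, mul_pow] at key
  have hA0 : 0 ≤ (ρ x₀ ^ 2 + a ^ 2) * ‖R (ρ x₀)‖ ^ 2 := by positivity
  have hB0 : 0 ≤ (delta M a (ρ x₀) / (ρ x₀ ^ 2 + a ^ 2)) ^ 2 *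
      ‖deriv (fun s : ℝ ↦ ((Real.sqrt (s ^ 2 + a ^ 2) : ℝ) : ℂ) * R s) (ρ x₀)‖ ^ 2 /
        (ω ^ 2 - sepPotential M a ω m Λ (ρ x₀)) := div_nonneg (by positivity) hΦ0.le
  refine ⟨by linarith, ?_⟩
  have h2 : (delta M a (ρ x₀) / (ρ x₀ ^ 2 + a ^ 2)) ^ 2 *
      ‖deriv (fun s : ℝ ↦ ((Real.sqrt (s ^ 2 + a ^ 2) : ℝ) : ℂ) * R s) (ρ x₀)‖ ^ 2 /
        (ω ^ 2 - sepPotential M a ω m Λ (ρ x₀)) ≤ 2 := by linarith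
  rwa [div_le_iff₀ hΦ0] at h2

end Costa2019

end Literature.Geometry.Lorentzian.Kerr

end
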